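import Summits.QuantumFields.YangMills.Theorems.UnitScaleTiltProp7CurvedLandauRowA
import Summits.QuantumFields.YangMills.Theorems.UnitScaleTiltProp7CurvedLandauRowE
import Summits.QuantumFields.YangMills.Theorems.UnitScaleTiltProp7CurvedLandauCoercivity
import HarnessLib

/-!
# Route `UnitScaleTilt`, crux K1 «MinimiserStabilityRegPr» (stmt-QuantumFields-19200), route-R [RP] curved — THE S2′ KNIT, d = 3 assembly:
# S2′ (✓ p601741 ∕ ✓ p607476) WITH THE STRUCTURE ROWS `hA`, `hE` DISCHARGED from the curved-N6 chain for the recursion families of record,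
# under ONE smallness numeral `10⁶·L⁵·ε ≤ 1`, modulo `hΛ` (★routeR-w2's (R-B)), the divergence budget and the true-average constraint budget:
# `((5∕8)·L^{−2(K−n)} − 18δ)·Σ_b‖Y_b‖² − 18Z − 96·L^{−(K−n)}·Z_Q ≤ 18·Σ‖D_{U₀}Y‖²_HS + 384·c_Λ·G`

Cell `ym3-torus`, keyed width hand `ym-routeR-w3` (D-0154 (3c); row (R1) «the S2′ knit» yielded by ★w2-20520 g3, OWNER ACK 26 (4)); sequel of `…CurvedLandauRowA` (`hA`)
and `…CurvedLandauRowE` (`hE` + displayed `Q`-budget, closed-form constants).  THEOREMS ONLY (0 `def`, 0 `sorry`); `--supports stmt-QuantumFields-19200`, count-neutral.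
YM₃ on T³ is a ladder rung (R3), not the Clay problem; nothing here claims the stub, the crux, d = 4 or the mass gap.

THE POINT.  §1 is S2′ with TWO budgets: ✓ p607476 §1 (`hdiv ↦ hdivB : Σ‖D^*_{U₀}Y‖²_HS ≤ δΣ‖Y‖² + Z`) with `hE` generalised to `Σ_cE_c² ≤ c_E·ℓ⁵ε²Σ‖Y‖² + Z_E`
(conclusion gains `−32ℓ⁻⁷Z_E`; engine bookkeeping verbatim, `ℓ = L^{K−n}`).  §2 runs the tower at `2ε` over the (14)-type NON-strict bound `dist1(U₀(∂p)) ≤ εℓ⁻²`: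
at d = 3, `SU(2)` (`δ₂ = 1∕3`) every smallness binder of parts A∕E (`tower_plaq_lt`'s two numerals, `((d+2)L)²·2ε ≤ 1∕12`, `159·d(d+2)³L^{d+2}·2ε ≤ 1`) and the engine's
`216ε ≤ 1` follow from `10⁶·L⁵·ε ≤ 1` (`L ≥ 3` odd); part A gives `hA` with `E_c := ℓ³(‖Q^{(k)}Y(c)‖ + ‖G_k(c) − S_k(c)‖ + ‖S_k(c) − X_c‖)`, part E gives
`Σ_cE_c² ≤ 3ℓ⁶·Σ_c‖Q^{(k)}Y(c)‖² + 12(C_G + C_S²)·ε²·ℓ⁵·Σ‖Y‖²` with `C_G = (4770L³)²(25L²∕2)²∕4`, `C_S = 250L²∕((L−1)(L²−1)) + (10L+7)²∕2`, and `384(C_G + C_S²)ε² ≤ 3∕8`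
under the numeral — so the coefficient `1 − 32c_Eε²` is AT LEAST `5∕8`.  DISPLAYED: `hΛ : Σ_y‖Λ_k(y)‖² ≤ c_Λ·ℓ·G` for the coarse gauge function OF RECORD (★routeR-w2's
✓p612184 `sum_normSq_covIterLambda_le` modulo its per-level rows), the divergence budget (`δ, Z`: ★routeR-w3 g0's ✓p607282 point-Landau budget ∕ the pinned-Landau fork)
and the constraint budget `Σ_c‖Q^{(k)}Y(c)‖² ≤ Z_Q` (`0` on the linearised fibre; the junction to ✓p611573's stencil-gauge `Q`-defect for a nonlinear pair is pending).

WHAT IS PROVED (ns `…Theorems.Prop7CurvedLandauKnitT3`): §1 ★ `sum_normSq_le_curl_sq_of_divBudget_of_structureBudget_T3` (S2′ with divergence AND `E` budgets, rows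
displayed); §2 `three_le_L`, `smallness_T3` (incl. `δ₂ ≥ 1∕3`), `cE_bound_T3`, ★★★ `sum_normSq_le_curl_sq_of_divBudget_of_tower_T3` (the knit).  HONEST SCOPE: bookkeeping
over the landed bricks; (R-B)'s per-level rows behind `hΛ`, the pinned ↔ Landau fork (S2″) and the `Q`-junction are NOT here; nothing of print is asserted beyond the tree.
References: T. Bałaban, CMP 99 (1985) 389–434 [Balaban1985BackgroundPropagators] ((3.8) p.392, Thm 3.11 p.416); CMP 102 (1985) 277–309 [Balaban1985Variational] ((14) p.280,
Prop. 7 p.299); CMP 95 (1984) 17–40 [Balaban1984PropagatorsI] ((1.18)–(1.20) pp.19–20); CMP 98 (1985) 17–51 [Balaban1985Averaging] (Prop. 2 (53) p.26).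
-/

set_option autoImplicit false

noncomputable section

open scoped BigOperators Matrix.Norms.L2Operator Matrix

namespace Summit.QuantumFields.YangMills.Theorems.Prop7CurvedLandauKnitT3

open Literature.MathematicalPhysics.QuantumFieldTheory.Balaban1983to89
open Literature.MathematicalPhysics.QuantumFieldTheory.Balaban1983to89.T3ContinuumYM3Torus
open Finset T4Continuum T4ReflectionCone BlockAveraging AveragingRT ExpMeanLog BlockAveragingEMLLinearised BlockAveragingEMLLinearisedBackground
  BlockAveragingEMLProp2 B1RG242Torus
open B15DeterminingSets (embIter)
open B7Prop1Explicit (treeWord)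
open B7Eq78Linearization (conjR)
open B9Eq39Adjoint (curl divB)
open B10Eq27TorusAxialLog (holT unitsField toUField)
open B9TorusCalculus (torusT)
open Summit.QuantumFields.YangMills.Theorems.Prop7CovariantCoercivity (sum_normSq_le_curl_sq_add_divB_sq_add_avg_T3)
open Summit.QuantumFields.YangMills.Theorems.Prop7CurvedLandauCoercivity (sum_sq_norm_add_le)
open Summit.QuantumFields.YangMills.Theorems.Prop7CovIterLambdaBound (tower_guard plaqSmall_of_le_of_lt)
open Summit.QuantumFields.YangMills.Theorems.Prop7CurvedLandauRowA (norm_engine_le_of_structure)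
open Summit.QuantumFields.YangMills.Theorems.Prop7CurvedLandauRowE (sum_sq_defect_le_of_tower)

/-! ## §1 ★ S2′ with the divergence budget AND an `E`-budget -/

/-- ★ **S2′ WITH TWO BUDGETS** — ✓ p607476 `sum_normSq_le_curl_sq_of_divBudget_of_structure_T3` VERBATIM except that the `E`-row carries an additive budget:
`Σ_cE_c² ≤ c_E·ℓ⁵·ε²·Σ‖Y‖² + Z_E`.  THEN `((1 − 32c_Eε²)·ℓ⁻² − 18δ)·Σ_b‖Y(b)‖² − 18Z − 32ℓ⁻⁷·Z_E ≤ 18·Σ_{x,μ<ν}‖(D_{U₀}Y)(p_{μν}(x))‖²_HS + 384·c_Λ·G` (`ℓ = L^{K−n}`).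
[cite: Balaban1985BackgroundPropagators, Thm 3.11 p.416] -/
theorem sum_normSq_le_curl_sq_of_divBudget_of_structureBudget_T3 (F : T3Family) (n K : ℕ)
    (U₀ : GaugeField (F.P K) 0 (Matrix.specialUnitaryGroup (Fin 2) ℂ)) {ε : ℝ} (hε : 0 ≤ ε) (hε1 : 216 * ε ≤ 1)
    (hU : ∀ p : Plaq (F.P K) 0, dist1 (GaugeField.plaqHol U₀ p) ≤ ε * (((F.L : ℝ) ^ (K - n)) ^ 2)⁻¹)
    (Y : PBond (F.P K) 0 → Matrix (Fin 2) (Fin 2) ℂ) {δ Z : ℝ}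
    (hdivB : ∑ x : Site (F.P K) 0, ∑ j : Fin 2, ∑ k : Fin 2,
        ‖(divB (torusT (F.P K) 0) (fun κ z => unitsField (toUField U₀) ⟨z, κ⟩) (fun κ z => Y ⟨z, κ⟩) x) j k‖ ^ 2
      ≤ δ * ∑ b : PBond (F.P K) 0, ‖Y b‖ ^ 2 + Z)
    (Λ : Site (F.P K) (K - n) → Matrix (Fin 2) (Fin 2) ℂ) (E : PBond (F.P K) (K - n) → ℝ) {G cΛ cE ZE : ℝ}
    (hA : ∀ c : PBond (F.P K) (K - n),
      ‖∑ r : Fin (F.P K).d → Fin ((F.P K).L ^ (K - n)), ∑ s ∈ Finset.range ((F.P K).L ^ (K - n)),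
        conjR (holT (unitsField (toUField U₀)) (Site.fibreSite 0 (K - n) c.src fun _ => ⟨0, pow_pos (F.P K).L_pos (K - n)⟩) (treeWord fun ν => ((r ν : ℕ) : ℤ))
            * holT (unitsField (toUField U₀)) (Site.fibreSite 0 (K - n) c.src r) (List.replicate s (c.dir, true)))
          (Y ⟨(fun z : Site (F.P K) 0 => z.shift c.dir)^[s] (Site.fibreSite 0 (K - n) c.src r), c.dir⟩)‖
        ≤ ((F.L : ℝ) ^ (K - n)) ^ 3 * (‖Λ c.tgt‖ + ‖Λ c.src‖) + E c)
    (hΛ : ∑ y : Site (F.P K) (K - n), ‖Λ y‖ ^ 2 ≤ cΛ * (F.L : ℝ) ^ (K - n) * G)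
    (hE : ∑ c : PBond (F.P K) (K - n), E c ^ 2 ≤ cE * ((F.L : ℝ) ^ (K - n)) ^ 5 * ε ^ 2 * ∑ b : PBond (F.P K) 0, ‖Y b‖ ^ 2 + ZE) :
    ((1 - 32 * cE * ε ^ 2) * (((F.L : ℝ) ^ (K - n)) ^ 2)⁻¹ - 18 * δ) * ∑ b : PBond (F.P K) 0, ‖Y b‖ ^ 2 - 18 * Z
        - 32 * (((F.L : ℝ) ^ (K - n)) ^ 7)⁻¹ * ZE
      ≤ 18 * ∑ x : Site (F.P K) 0, ∑ μ : Fin (F.P K).d, ∑ ν : Fin (F.P K).d,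
            (if μ < ν then ∑ j : Fin 2, ∑ k : Fin 2,
              ‖(curl (torusT (F.P K) 0) (fun κ z => unitsField (toUField U₀) ⟨z, κ⟩) (fun κ z => Y ⟨z, κ⟩) μ ν x) j k‖ ^ 2 else 0)
        + 384 * cΛ * G := by
  have hLpos : (0 : ℝ) < (F.L : ℝ) := by have := F.hL.2; exact_mod_cast (by omega : 0 < F.L)
  have hℓ : (0 : ℝ) < (F.L : ℝ) ^ (K - n) := pow_pos hLpos _
  have hd : (F.P K).d = 3 := T3Family.P_d F K
  have heng := sum_normSq_le_curl_sq_add_divB_sq_add_avg_T3 F n K U₀ hε hε1 hU Y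
  have hdpow : ((F.L : ℝ) ^ (K - n)) ^ (F.P K).d = ((F.L : ℝ) ^ (K - n)) ^ 3 := by rw [hd]
  rw [hdpow] at heng
  have hAVG : ∑ c : PBond (F.P K) (K - n),
      ‖∑ r : Fin (F.P K).d → Fin ((F.P K).L ^ (K - n)), ∑ s ∈ Finset.range ((F.P K).L ^ (K - n)),
        conjR (holT (unitsField (toUField U₀)) (Site.fibreSite 0 (K - n) c.src fun _ => ⟨0, pow_pos (F.P K).L_pos (K - n)⟩) (treeWord fun ν => ((r ν : ℕ) : ℤ))
            * holT (unitsField (toUField U₀)) (Site.fibreSite 0 (K - n) c.src r) (List.replicate s (c.dir, true)))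
          (Y ⟨(fun z : Site (F.P K) 0 => z.shift c.dir)^[s] (Site.fibreSite 0 (K - n) c.src r), c.dir⟩)‖ ^ 2
      ≤ 8 * (F.P K).d * (((F.L : ℝ) ^ (K - n)) ^ 3) ^ 2 * ∑ y : Site (F.P K) (K - n), ‖Λ y‖ ^ 2 + 2 * ∑ c : PBond (F.P K) (K - n), E c ^ 2 := by
    refine le_trans ?_ (sum_sq_norm_add_le (((F.L : ℝ) ^ (K - n)) ^ 3) Λ E)
    refine Finset.sum_le_sum fun c _ => ?_
    have h0 := norm_nonneg (∑ r : Fin (F.P K).d → Fin ((F.P K).L ^ (K - n)), ∑ s ∈ Finset.range ((F.P K).L ^ (K - n)),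
        conjR (holT (unitsField (toUField U₀)) (Site.fibreSite 0 (K - n) c.src fun _ => ⟨0, pow_pos (F.P K).L_pos (K - n)⟩) (treeWord fun ν => ((r ν : ℕ) : ℤ))
            * holT (unitsField (toUField U₀)) (Site.fibreSite 0 (K - n) c.src r) (List.replicate s (c.dir, true)))
          (Y ⟨(fun z : Site (F.P K) 0 => z.shift c.dir)^[s] (Site.fibreSite 0 (K - n) c.src r), c.dir⟩))
    exact pow_le_pow_left₀ h0 (hA c) 2
  have hd3 : ((F.P K).d : ℝ) = 3 := by rw [hd]; norm_num
  rw [hd3] at hAVG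
  set ℓ : ℝ := (F.L : ℝ) ^ (K - n) with hℓdef
  set SY : ℝ := ∑ b : PBond (F.P K) 0, ‖Y b‖ ^ 2 with hSYdef
  have hSY : 0 ≤ SY := by positivity
  have hpen : 16 * (((ℓ ^ 3) * ℓ ^ 2)⁻¹ * (ℓ ^ 2)⁻¹) * (8 * 3 * (ℓ ^ 3) ^ 2 * ∑ y : Site (F.P K) (K - n), ‖Λ y‖ ^ 2
        + 2 * ∑ c : PBond (F.P K) (K - n), E c ^ 2)
      ≤ 384 * cΛ * G + 32 * cE * ε ^ 2 * ((ℓ ^ 2)⁻¹ * SY) + 32 * (ℓ ^ 7)⁻¹ * ZE := by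
    have h1 : 16 * (((ℓ ^ 3) * ℓ ^ 2)⁻¹ * (ℓ ^ 2)⁻¹) * (8 * 3 * (ℓ ^ 3) ^ 2 * ∑ y : Site (F.P K) (K - n), ‖Λ y‖ ^ 2)
        = 384 * ℓ⁻¹ * ∑ y : Site (F.P K) (K - n), ‖Λ y‖ ^ 2 := by
      field_simp
      ring
    have h2 : 16 * (((ℓ ^ 3) * ℓ ^ 2)⁻¹ * (ℓ ^ 2)⁻¹) * (2 * ∑ c : PBond (F.P K) (K - n), E c ^ 2)
        = 32 * (ℓ ^ 7)⁻¹ * ∑ c : PBond (F.P K) (K - n), E c ^ 2 := by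
      field_simp
      ring
    rw [mul_add, h1, h2]
    have h3 : 384 * ℓ⁻¹ * ∑ y : Site (F.P K) (K - n), ‖Λ y‖ ^ 2 ≤ 384 * cΛ * G := by
      calc 384 * ℓ⁻¹ * ∑ y : Site (F.P K) (K - n), ‖Λ y‖ ^ 2 ≤ 384 * ℓ⁻¹ * (cΛ * ℓ * G) :=
            mul_le_mul_of_nonneg_left hΛ (by positivity)
        _ = 384 * cΛ * G := by field_simp
    have h4 : 32 * (ℓ ^ 7)⁻¹ * ∑ c : PBond (F.P K) (K - n), E c ^ 2 ≤ 32 * cE * ε ^ 2 * ((ℓ ^ 2)⁻¹ * SY) + 32 * (ℓ ^ 7)⁻¹ * ZE := by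
      calc 32 * (ℓ ^ 7)⁻¹ * ∑ c : PBond (F.P K) (K - n), E c ^ 2 ≤ 32 * (ℓ ^ 7)⁻¹ * (cE * ℓ ^ 5 * ε ^ 2 * SY + ZE) :=
            mul_le_mul_of_nonneg_left hE (by positivity)
        _ = 32 * cE * ε ^ 2 * ((ℓ ^ 2)⁻¹ * SY) + 32 * (ℓ ^ 7)⁻¹ * ZE := by field_simp
    linarith
  have hK : (0 : ℝ) ≤ 16 * (((ℓ ^ 3) * ℓ ^ 2)⁻¹ * (ℓ ^ 2)⁻¹) := by positivity
  have hmain := heng.trans (add_le_add le_rfl (mul_le_mul_of_nonneg_left hAVG hK))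
  have e : ((1 - 32 * cE * ε ^ 2) * (ℓ ^ 2)⁻¹ - 18 * δ) * SY
      = (ℓ ^ 2)⁻¹ * SY - 32 * cE * ε ^ 2 * ((ℓ ^ 2)⁻¹ * SY) - 18 * (δ * SY) := by
    ring
  rw [e]
  linarith [hmain, hpen, hdivB]

/-! ## §2 ★★★ The knit: `hA` ∕ `hE` discharged from the tower at d = 3 -/
/-- `L ≥ 3` for an odd `L > 1`. [folklore] -/
theorem three_le_L (F : T3Family) : (3 : ℝ) ≤ (F.L : ℝ) := by
  have h1 := F.hL.2
  have : 3 ≤ F.L := by rcases F.hL.1 with ⟨m, hm⟩; omega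
  exact_mod_cast this
/-- THE NUMERALS: at d = 3, `SU(2)`, `L ≥ 3`, the single smallness `10⁶·L⁵·ε ≤ 1` implies the engine's `216ε ≤ 1` and, for the tower run at `2ε`, the two
[B7] Prop. 2 numerals of `tower_plaq_lt`, `((d+2)L)²(2ε) ≤ 1/12` and `159·d(d+2)³·L^{d+2}·(2ε) ≤ 1`. [folklore] -/
theorem smallness_T3 (F : T3Family) (K : ℕ) {ε : ℝ} (hε : 0 < ε) (hεL : 1000000 * (F.L : ℝ) ^ 5 * ε ≤ 1) :
    216 * ε ≤ 1 ∧
      (143 * (((((F.P K).d + 4 : ℕ) : ℝ)) ^ 2 / 4) ^ 2) * (2 * ε) ≤ 1 / 3 ∧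
      2 * (2 * ε) ≤ 2 * deltaSU (Fin 2) / ((((F.P K).d + 4) * (F.P K).L : ℕ) : ℝ) ^ 2 ∧
      ((((F.P K).d + 2) * (F.P K).L : ℕ) : ℝ) ^ 2 * (2 * ε) ≤ 1 / 12 ∧
      159 * (F.P K).d * (((F.P K).d : ℝ) + 2) ^ 3 * ((F.P K).L : ℝ) ^ ((F.P K).d + 2) * (2 * ε) ≤ 1 := by
  have hd : (F.P K).d = 3 := T3Family.P_d F K
  have hLF : (F.P K).L = F.L := rfl
  rw [hd, hLF]
  have hL3 := three_le_L F
  have hL1 : (1 : ℝ) ≤ (F.L : ℝ) := by linarith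
  have hL5 : (F.L : ℝ) ^ 2 ≤ (F.L : ℝ) ^ 5 := pow_le_pow_right₀ hL1 (by norm_num)
  have hL2' : (1 : ℝ) ≤ (F.L : ℝ) ^ 2 := one_le_pow₀ hL1
  have hε2' : (F.L : ℝ) ^ 2 * ε ≤ 1 / 1000000 := by nlinarith
  have hε1' : ε ≤ 1 / 1000000 := by nlinarith
  have hδ : (1 : ℝ) / 3 ≤ deltaSU (Fin 2) := by  -- `δ₂ = min(1/3, π/2)`; cf. `HistoryTailBoundedHeight.third_le_deltaSU_two`
    unfold deltaSU
    refine le_min le_rfl ?_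
    rw [Fintype.card_fin]
    have := Real.pi_gt_three
    push_cast
    linarith
  refine ⟨by linarith, ?_, ?_, ?_, ?_⟩
  · push_cast; nlinarith
  · push_cast
    rw [le_div_iff₀ (by positivity)]
    nlinarith
  · push_cast; nlinarith
  · push_cast; nlinarith

/-- THE `c_E` NUMERAL: with `C_G = (4770L³)²(25L²/2)²/4`, `C_S = 250L²/((L−1)(L²−1)) + (10L+7)²/2` (parts A∕E at d = 3) and `10⁶·L⁵·ε ≤ 1`, `L ≥ 3`:
`384·(C_G + C_S²)·ε² ≤ 3/8`. [folklore] -/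
theorem cE_bound_T3 (F : T3Family) {ε : ℝ} (hε : 0 < ε) (hεL : 1000000 * (F.L : ℝ) ^ 5 * ε ≤ 1) :
    384 * ((4770 * (F.L : ℝ) ^ 3) ^ 2 * ((5 * (F.L : ℝ)) ^ 2 / 2) ^ 2 / 4
              + (2 * (5 * (F.L : ℝ)) ^ 3 / ((F.L : ℝ) * ((F.L : ℝ) - 1) * ((F.L : ℝ) ^ 2 - 1)) + (2 * (5 * (F.L : ℝ)) + 2 * 3 + 1) ^ 2 / 2) ^ 2) * ε ^ 2 ≤ 3 / 8 := by
  have hL3 := three_le_L F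
  set L : ℝ := (F.L : ℝ) with hLdef
  have hL0 : 0 < L := by linarith
  have hden : 16 ≤ L * (L - 1) * (L ^ 2 - 1) / L := by
    rw [le_div_iff₀ hL0]
    nlinarith [mul_le_mul hL3 (by nlinarith : (8:ℝ) ≤ L ^ 2 - 1) (by norm_num) (by linarith)]
  have hCS1 : 2 * (5 * L) ^ 3 / (L * (L - 1) * (L ^ 2 - 1)) ≤ 16 * L ^ 2 := by
    have hpos : 0 < L * (L - 1) * (L ^ 2 - 1) := by
      have : 0 < L - 1 := by linarith
      have : 0 < L ^ 2 - 1 := by nlinarith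
      positivity
    rw [div_le_iff₀ hpos]
    have : 16 * L ≤ L * (L - 1) * (L ^ 2 - 1) := by
      have h := hden; rw [le_div_iff₀ hL0] at h; linarith
    nlinarith
  have hCS2 : (2 * (5 * L) + 2 * 3 + 1) ^ 2 / 2 ≤ 85 * L ^ 2 := by nlinarith
  have hCS : 2 * (5 * L) ^ 3 / (L * (L - 1) * (L ^ 2 - 1)) + (2 * (5 * L) + 2 * 3 + 1) ^ 2 / 2 ≤ 101 * L ^ 2 := by linarith
  have hCS0 : 0 ≤ 2 * (5 * L) ^ 3 / (L * (L - 1) * (L ^ 2 - 1)) + (2 * (5 * L) + 2 * 3 + 1) ^ 2 / 2 := by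
    have : 0 < L - 1 := by linarith
    have : 0 < L ^ 2 - 1 := by nlinarith
    positivity
  have hu : L ^ 5 * ε ≤ 1 / 1000000 := by linarith
  have hu0 : 0 ≤ L ^ 5 * ε := by positivity
  have hCG : 384 * ((4770 * L ^ 3) ^ 2 * ((5 * L) ^ 2 / 2) ^ 2 / 4) * ε ^ 2 ≤ 11 / 32 := by
    have : (4770 * L ^ 3) ^ 2 * ((5 * L) ^ 2 / 2) ^ 2 / 4 * ε ^ 2 = (4770 ^ 2 * 625 / 16) * (L ^ 5 * ε) ^ 2 := by ring
    rw [mul_assoc, this]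
    nlinarith [mul_le_mul hu hu hu0 (by norm_num)]
  have hCSε : 384 * (2 * (5 * L) ^ 3 / (L * (L - 1) * (L ^ 2 - 1)) + (2 * (5 * L) + 2 * 3 + 1) ^ 2 / 2) ^ 2 * ε ^ 2 ≤ 1 / 32 := by
    have h1 : (2 * (5 * L) ^ 3 / (L * (L - 1) * (L ^ 2 - 1)) + (2 * (5 * L) + 2 * 3 + 1) ^ 2 / 2) ^ 2 ≤ (101 * L ^ 2) ^ 2 :=
      pow_le_pow_left₀ hCS0 hCS 2
    have h2 : (101 * L ^ 2) ^ 2 * ε ^ 2 ≤ 101 ^ 2 * (L ^ 5 * ε) ^ 2 := by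
      have hL1 : 1 ≤ L := by linarith
      have : L ^ 4 ≤ L ^ 10 := pow_le_pow_right₀ hL1 (by norm_num)
      nlinarith [sq_nonneg ε]
    nlinarith [mul_le_mul hu hu hu0 (by norm_num), sq_nonneg ε]
  nlinarith

/-- ★★★ **THE S2′ KNIT — S2′ WITH `hA`∕`hE` DISCHARGED FROM THE CURVED-N6 CHAIN (d = 3, `SU(2)`).**  Background `U₀` on the finest torus of run `K` with the (14)-type bound
`dist1(U₀(∂p)) ≤ ε·L^{−2(K−n)}`, `0 < ε`, `10⁶·L⁵·ε ≤ 1`; bond field `Y` with the divergence budget `Σ_x‖(D^*_{U₀}Y)(x)‖²_HS ≤ δ·Σ‖Y‖² + Z`.  The recursion families OF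
RECORD along the background tower (all DISPLAYED by their recursions; they exist by `…CurvedLandauRowA` §0 and ✓ `exists_pureLine_family`): `Q` the true linearised
iterate, `G` the reduced family and `Λ` the coarse gauge function at the covariant comb mean (✓ p606268), `S` the pure `LINE` family (✓ p608741).  DISPLAYED ROWS: ONLY
`hΛ : Σ_y‖Λ_{K−n}(y)‖² ≤ c_Λ·L^{K−n}·G` (★routeR-w2's (R-B)) and the constraint budget `Σ_c‖Q^{(K−n)}Y(c)‖² ≤ Z_Q` (`0` on the linearised fibre).  THEN
`((5∕8)·L^{−2(K−n)} − 18δ)·Σ_b‖Y(b)‖² − 18Z − 96·L^{−(K−n)}·Z_Q ≤ 18·Σ_{x,μ<ν}‖(D_{U₀}Y)(p_{μν}(x))‖²_HS + 384·c_Λ·G` — the `hA`∕`hE` rows of ✓ p601741 are theorems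
(`…RowA`, `…RowE`, `32c_Eε² ≤ 3∕8` by `cE_bound_T3`). [cite: Balaban1985BackgroundPropagators, Thm 3.11 p.416; Balaban1985Variational, (14) p.280, Prop. 7 p.299] -/
theorem sum_normSq_le_curl_sq_of_divBudget_of_tower_T3 (F : T3Family) (n K : ℕ)
    (U₀ : GaugeField (F.P K) 0 (Matrix.specialUnitaryGroup (Fin 2) ℂ)) {ε : ℝ} (hε : 0 < ε) (hεL : 1000000 * (F.L : ℝ) ^ 5 * ε ≤ 1)
    (hU : ∀ p : Plaq (F.P K) 0, dist1 (GaugeField.plaqHol U₀ p) ≤ ε * (((F.L : ℝ) ^ (K - n)) ^ 2)⁻¹)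
    (Q : (k : ℕ) → (PBond (F.P K) 0 → Matrix (Fin 2) (Fin 2) ℂ) → PBond (F.P K) k → Matrix (Fin 2) (Fin 2) ℂ) (hQ0 : ∀ Y, Q 0 Y = Y)
    (hQs : ∀ (k : ℕ) (Y : PBond (F.P K) 0 → Matrix (Fin 2) (Fin 2) ℂ) (c : PBond (F.P K) (k + 1)), Q (k + 1) Y c
      = fderiv ℂ (eml : (Idx (F.P K) → Matrix (Fin 2) (Fin 2) ℂ) → Matrix (Fin 2) (Fin 2) ℂ)
            (fun i => ((loopHol (Averaging.iter (fun i => blockAvg (P := F.P K) (j := i) (expMeanLogSU (n := Fin 2))) k U₀) c i :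
              Matrix.specialUnitaryGroup (Fin 2) ℂ) : Matrix (Fin 2) (Fin 2) ℂ))
            (fun i => covWalkSum (Averaging.iter (fun i => blockAvg (P := F.P K) (j := i) (expMeanLogSU (n := Fin 2))) k U₀) (Q k Y)
                (walk (emb c.src) (loopWord (F.P K).L c.dir (off i.1) i.2.1 i.2.2))
              * ((loopHol (Averaging.iter (fun i => blockAvg (P := F.P K) (j := i) (expMeanLogSU (n := Fin 2))) k U₀) c i :
                Matrix.specialUnitaryGroup (Fin 2) ℂ) : Matrix (Fin 2) (Fin 2) ℂ))
            * star ((corr (expMeanLogSU (n := Fin 2)) (Averaging.iter (fun i => blockAvg (P := F.P K) (j := i) (expMeanLogSU (n := Fin 2))) k U₀) c :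
                Matrix.specialUnitaryGroup (Fin 2) ℂ) : Matrix (Fin 2) (Fin 2) ℂ)
          + ((corr (expMeanLogSU (n := Fin 2)) (Averaging.iter (fun i => blockAvg (P := F.P K) (j := i) (expMeanLogSU (n := Fin 2))) k U₀) c :
                Matrix.specialUnitaryGroup (Fin 2) ℂ) : Matrix (Fin 2) (Fin 2) ℂ)
            * covWalkSum (Averaging.iter (fun i => blockAvg (P := F.P K) (j := i) (expMeanLogSU (n := Fin 2))) k U₀) (Q k Y)
                (walk (emb c.src) (List.replicate (F.P K).L (c.dir, true)))
            * star ((corr (expMeanLogSU (n := Fin 2)) (Averaging.iter (fun i => blockAvg (P := F.P K) (j := i) (expMeanLogSU (n := Fin 2))) k U₀) c :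
                Matrix.specialUnitaryGroup (Fin 2) ℂ) : Matrix (Fin 2) (Fin 2) ℂ))
    (Y : PBond (F.P K) 0 → Matrix (Fin 2) (Fin 2) ℂ)
    (G S : (k : ℕ) → PBond (F.P K) k → Matrix (Fin 2) (Fin 2) ℂ) (Λ : (k : ℕ) → Site (F.P K) k → Matrix (Fin 2) (Fin 2) ℂ)
    (hG0 : ∀ b, G 0 b = Y b) (hS0 : ∀ b, S 0 b = Y b) (hΛ0 : ∀ x, Λ 0 x = 0)
    (hΛs : ∀ (k : ℕ) (z : Site (F.P K) (k + 1)), Λ (k + 1) z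
      = ((Fintype.card (Idx (F.P K)) : ℂ))⁻¹ • ∑ i : Idx (F.P K),
          covWalkSum (Averaging.iter (fun i => blockAvg (P := F.P K) (j := i) (expMeanLogSU (n := Fin 2))) k U₀) (G k)
            (walk (emb z) (stairWord i.2.1 (off i.1)))
        + Λ k (emb z))
    (hGs : ∀ (k : ℕ) (c : PBond (F.P K) (k + 1)), G (k + 1) c
      = (fderiv ℂ (eml : (Idx (F.P K) → Matrix (Fin 2) (Fin 2) ℂ) → Matrix (Fin 2) (Fin 2) ℂ)
            (fun i => ((loopHol (Averaging.iter (fun i => blockAvg (P := F.P K) (j := i) (expMeanLogSU (n := Fin 2))) k U₀) c i :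
              Matrix.specialUnitaryGroup (Fin 2) ℂ) : Matrix (Fin 2) (Fin 2) ℂ))
            (fun i => covWalkSum (Averaging.iter (fun i => blockAvg (P := F.P K) (j := i) (expMeanLogSU (n := Fin 2))) k U₀) (G k)
                (walk (emb c.src) (loopWord (F.P K).L c.dir (off i.1) i.2.1 i.2.2))
              * ((loopHol (Averaging.iter (fun i => blockAvg (P := F.P K) (j := i) (expMeanLogSU (n := Fin 2))) k U₀) c i :
                Matrix.specialUnitaryGroup (Fin 2) ℂ) : Matrix (Fin 2) (Fin 2) ℂ))
            * star ((corr (expMeanLogSU (n := Fin 2)) (Averaging.iter (fun i => blockAvg (P := F.P K) (j := i) (expMeanLogSU (n := Fin 2))) k U₀) c :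
                Matrix.specialUnitaryGroup (Fin 2) ℂ) : Matrix (Fin 2) (Fin 2) ℂ)
          + ((corr (expMeanLogSU (n := Fin 2)) (Averaging.iter (fun i => blockAvg (P := F.P K) (j := i) (expMeanLogSU (n := Fin 2))) k U₀) c :
                Matrix.specialUnitaryGroup (Fin 2) ℂ) : Matrix (Fin 2) (Fin 2) ℂ)
            * covWalkSum (Averaging.iter (fun i => blockAvg (P := F.P K) (j := i) (expMeanLogSU (n := Fin 2))) k U₀) (G k)
                (walk (emb c.src) (List.replicate (F.P K).L (c.dir, true)))
            * star ((corr (expMeanLogSU (n := Fin 2)) (Averaging.iter (fun i => blockAvg (P := F.P K) (j := i) (expMeanLogSU (n := Fin 2))) k U₀) c :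
                Matrix.specialUnitaryGroup (Fin 2) ℂ) : Matrix (Fin 2) (Fin 2) ℂ))
        - ((((Fintype.card (Idx (F.P K)) : ℂ))⁻¹ • ∑ i : Idx (F.P K),
              covWalkSum (Averaging.iter (fun i => blockAvg (P := F.P K) (j := i) (expMeanLogSU (n := Fin 2))) k U₀) (G k) (walk (emb c.src) (stairWord i.2.1 (off i.1))))
            - ((Averaging.iter (fun i => blockAvg (P := F.P K) (j := i) (expMeanLogSU (n := Fin 2))) (k + 1) U₀ c : Matrix.specialUnitaryGroup (Fin 2) ℂ) :
                Matrix (Fin 2) (Fin 2) ℂ)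
              * (((Fintype.card (Idx (F.P K)) : ℂ))⁻¹ • ∑ i : Idx (F.P K),
                  covWalkSum (Averaging.iter (fun i => blockAvg (P := F.P K) (j := i) (expMeanLogSU (n := Fin 2))) k U₀) (G k) (walk (emb c.tgt) (stairWord i.2.1 (off i.1))))
              * star ((Averaging.iter (fun i => blockAvg (P := F.P K) (j := i) (expMeanLogSU (n := Fin 2))) (k + 1) U₀ c :
                Matrix.specialUnitaryGroup (Fin 2) ℂ) : Matrix (Fin 2) (Fin 2) ℂ)))
    (hSs : ∀ (k : ℕ) (c : PBond (F.P K) (k + 1)), S (k + 1) c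
      = ((Fintype.card (Idx (F.P K)) : ℂ))⁻¹ • ∑ i : Idx (F.P K),
          ((holAt (Averaging.iter (fun i => blockAvg (P := F.P K) (j := i) (expMeanLogSU (n := Fin 2))) k U₀) (walk (emb c.src) (stairWord i.2.1 (off i.1))) :
              Matrix.specialUnitaryGroup (Fin 2) ℂ) : Matrix (Fin 2) (Fin 2) ℂ) *
            covWalkSum (Averaging.iter (fun i => blockAvg (P := F.P K) (j := i) (expMeanLogSU (n := Fin 2))) k U₀) (S k)
              (walk (walkEnd (emb c.src) (stairWord i.2.1 (off i.1))) (List.replicate (F.P K).L (c.dir, true))) *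
          star ((holAt (Averaging.iter (fun i => blockAvg (P := F.P K) (j := i) (expMeanLogSU (n := Fin 2))) k U₀) (walk (emb c.src) (stairWord i.2.1 (off i.1))) :
              Matrix.specialUnitaryGroup (Fin 2) ℂ) : Matrix (Fin 2) (Fin 2) ℂ))
    {δ Z : ℝ}
    (hdivB : ∑ x : Site (F.P K) 0, ∑ j : Fin 2, ∑ k : Fin 2,
        ‖(divB (torusT (F.P K) 0) (fun κ z => unitsField (toUField U₀) ⟨z, κ⟩) (fun κ z => Y ⟨z, κ⟩) x) j k‖ ^ 2
      ≤ δ * ∑ b : PBond (F.P K) 0, ‖Y b‖ ^ 2 + Z)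
    {G₀ cΛ ZQ : ℝ} (hΛ : ∑ y : Site (F.P K) (K - n), ‖Λ (K - n) y‖ ^ 2 ≤ cΛ * (F.L : ℝ) ^ (K - n) * G₀)
    (hQ : ∑ c : PBond (F.P K) (K - n), ‖Q (K - n) Y c‖ ^ 2 ≤ ZQ) :
    ((5 / 8) * (((F.L : ℝ) ^ (K - n)) ^ 2)⁻¹ - 18 * δ) * ∑ b : PBond (F.P K) 0, ‖Y b‖ ^ 2 - 18 * Z - 96 * ((F.L : ℝ) ^ (K - n))⁻¹ * ZQ
      ≤ 18 * ∑ x : Site (F.P K) 0, ∑ μ : Fin (F.P K).d, ∑ ν : Fin (F.P K).d,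
            (if μ < ν then ∑ j : Fin 2, ∑ k : Fin 2,
              ‖(curl (torusT (F.P K) 0) (fun κ z => unitsField (toUField U₀) ⟨z, κ⟩) (fun κ z => Y ⟨z, κ⟩) μ ν x) j k‖ ^ 2 else 0)
        + 384 * cΛ * G₀ := by
  have hLpos : (0 : ℝ) < (F.L : ℝ) := by have := F.hL.2; exact_mod_cast (by omega : 0 < F.L)
  have hℓ : (0 : ℝ) < (F.L : ℝ) ^ (K - n) := pow_pos hLpos _
  have hd : (F.P K).d = 3 := T3Family.P_d F K
  have hLF : (F.P K).L = F.L := rfl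
  have hk : K - n ≤ (F.P K).m + (F.P K).K := by show K - n ≤ F.m + K; omega
  obtain ⟨hε1, hε3, hε2, hε24, hεκ⟩ := smallness_T3 F K hε hεL
  have hε' : 0 < 2 * ε := by linarith only [hε]
  have hU' : PlaqSmall (2 * ε * ((((F.P K).L : ℝ) ^ (K - n))⁻¹) ^ 2) U₀ := by
    refine plaqSmall_of_le_of_lt hU ?_
    rw [hLF, inv_pow]
    exact mul_lt_mul_of_pos_right (by linarith only [hε]) (inv_pos.mpr (by positivity))
  have hg := tower_guard (n := Fin 2) (K - n) hε' hε3 hε2 hU'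
  have hA : ∀ c : PBond (F.P K) (K - n),
      ‖∑ r : Fin (F.P K).d → Fin ((F.P K).L ^ (K - n)), ∑ s ∈ Finset.range ((F.P K).L ^ (K - n)),
        conjR (holT (unitsField (toUField U₀)) (Site.fibreSite 0 (K - n) c.src fun _ => ⟨0, pow_pos (F.P K).L_pos (K - n)⟩) (treeWord fun ν => ((r ν : ℕ) : ℤ))
            * holT (unitsField (toUField U₀)) (Site.fibreSite 0 (K - n) c.src r) (List.replicate s (c.dir, true)))
          (Y ⟨(fun z : Site (F.P K) 0 => z.shift c.dir)^[s] (Site.fibreSite 0 (K - n) c.src r), c.dir⟩)‖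
        ≤ ((F.L : ℝ) ^ (K - n)) ^ 3 * (‖Λ (K - n) c.tgt‖ + ‖Λ (K - n) c.src‖)
          + (((F.P K).L : ℝ) ^ (K - n)) ^ (F.P K).d * (‖Q (K - n) Y c‖ + ‖G (K - n) c - S (K - n) c‖
          + ‖S (K - n) c - ((((F.P K).L : ℂ) ^ (K - n)) ^ (F.P K).d)⁻¹ •
        (((holAt U₀ (walk (embIter (K - n) c.src) (treeWord fun _ : Fin (F.P K).d => -((((F.P K).L ^ (K - n) - 1) / 2 : ℕ) : ℤ))) : Matrix.specialUnitaryGroup (Fin 2) ℂ) :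
            Matrix (Fin 2) (Fin 2) ℂ)
          * (∑ r : Fin (F.P K).d → Fin ((F.P K).L ^ (K - n)), ∑ s ∈ Finset.range ((F.P K).L ^ (K - n)),
              conjR (holT (unitsField (toUField U₀)) (Site.fibreSite 0 (K - n) c.src fun _ => ⟨0, pow_pos (F.P K).L_pos (K - n)⟩) (treeWord fun ν => ((r ν : ℕ) : ℤ))
                  * holT (unitsField (toUField U₀)) (Site.fibreSite 0 (K - n) c.src r) (List.replicate s (c.dir, true)))
                (Y ⟨(fun z : Site (F.P K) 0 => z.shift c.dir)^[s] (Site.fibreSite 0 (K - n) c.src r), c.dir⟩))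
          * star (((holAt U₀ (walk (embIter (K - n) c.src) (treeWord fun _ : Fin (F.P K).d => -((((F.P K).L ^ (K - n) - 1) / 2 : ℕ) : ℤ))) : Matrix.specialUnitaryGroup (Fin 2) ℂ) :
              Matrix (Fin 2) (Fin 2) ℂ)))‖) :=
    fun c => norm_engine_le_of_structure U₀ Q hQ0 hQs Y G Λ hG0 hΛ0 hΛs hGs hg (S (K - n)) c
  have hE := sum_sq_defect_le_of_tower hk U₀ Y G S hG0 hS0 hGs hSs hε' hε3 hε2 hε24 hU' hεκ (Q (K - n) Y)
  have hcE := cE_bound_T3 F hε hεL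
  have hCGS0 : (0 : ℝ) ≤ ((4770 * (F.L : ℝ) ^ 3) ^ 2 * ((5 * (F.L : ℝ)) ^ 2 / 2) ^ 2 / 4
              + (2 * (5 * (F.L : ℝ)) ^ 3 / ((F.L : ℝ) * ((F.L : ℝ) - 1) * ((F.L : ℝ) ^ 2 - 1)) + (2 * (5 * (F.L : ℝ)) + 2 * 3 + 1) ^ 2 / 2) ^ 2) := by
    have hL3 := three_le_L F
    have : 0 < (F.L : ℝ) - 1 := by linarith only [hL3]
    have : 0 < (F.L : ℝ) ^ 2 - 1 := by nlinarith only [hL3]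
    positivity
  have hE' : ∑ c : PBond (F.P K) (K - n), ((((F.P K).L : ℝ) ^ (K - n)) ^ (F.P K).d * (‖Q (K - n) Y c‖ + ‖G (K - n) c - S (K - n) c‖
          + ‖S (K - n) c - ((((F.P K).L : ℂ) ^ (K - n)) ^ (F.P K).d)⁻¹ •
        (((holAt U₀ (walk (embIter (K - n) c.src) (treeWord fun _ : Fin (F.P K).d => -((((F.P K).L ^ (K - n) - 1) / 2 : ℕ) : ℤ))) : Matrix.specialUnitaryGroup (Fin 2) ℂ) :
            Matrix (Fin 2) (Fin 2) ℂ)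
          * (∑ r : Fin (F.P K).d → Fin ((F.P K).L ^ (K - n)), ∑ s ∈ Finset.range ((F.P K).L ^ (K - n)),
              conjR (holT (unitsField (toUField U₀)) (Site.fibreSite 0 (K - n) c.src fun _ => ⟨0, pow_pos (F.P K).L_pos (K - n)⟩) (treeWord fun ν => ((r ν : ℕ) : ℤ))
                  * holT (unitsField (toUField U₀)) (Site.fibreSite 0 (K - n) c.src r) (List.replicate s (c.dir, true)))
                (Y ⟨(fun z : Site (F.P K) 0 => z.shift c.dir)^[s] (Site.fibreSite 0 (K - n) c.src r), c.dir⟩))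
          * star (((holAt U₀ (walk (embIter (K - n) c.src) (treeWord fun _ : Fin (F.P K).d => -((((F.P K).L ^ (K - n) - 1) / 2 : ℕ) : ℤ))) : Matrix.specialUnitaryGroup (Fin 2) ℂ) :
              Matrix (Fin 2) (Fin 2) ℂ)))‖)) ^ 2
      ≤ 12 * ((4770 * (F.L : ℝ) ^ 3) ^ 2 * ((5 * (F.L : ℝ)) ^ 2 / 2) ^ 2 / 4
              + (2 * (5 * (F.L : ℝ)) ^ 3 / ((F.L : ℝ) * ((F.L : ℝ) - 1) * ((F.L : ℝ) ^ 2 - 1)) + (2 * (5 * (F.L : ℝ)) + 2 * 3 + 1) ^ 2 / 2) ^ 2)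
          * ((F.L : ℝ) ^ (K - n)) ^ 5 * ε ^ 2 * ∑ b : PBond (F.P K) 0, ‖Y b‖ ^ 2 + 3 * ((F.L : ℝ) ^ (K - n)) ^ 6 * ZQ := by
    refine hE.trans ?_
    rw [hd]
    simp only [hLF]
    push_cast
    have e1 : (3 : ℝ) * (((F.L : ℝ) ^ (K - n)) ^ 3) ^ 2 * ∑ c : PBond (F.P K) (K - n), ‖Q (K - n) Y c‖ ^ 2 ≤ 3 * ((F.L : ℝ) ^ (K - n)) ^ 6 * ZQ := by
      have : (((F.L : ℝ) ^ (K - n)) ^ 3) ^ 2 = ((F.L : ℝ) ^ (K - n)) ^ 6 := by ring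
      rw [this]; exact mul_le_mul_of_nonneg_left hQ (by positivity)
    have e2 : (3 : ℝ) * ((318 * 3 * (3 + 2) * (F.L : ℝ) ^ 3) ^ 2 * (((3 + 2) * (F.L : ℝ)) ^ 2 / 2) ^ 2 / 4
          + (2 * ((3 + 2) * (F.L : ℝ)) ^ 3 / ((F.L : ℝ) * ((F.L : ℝ) - 1) * ((F.L : ℝ) ^ 2 - 1))
              + (2 * ((3 + 2) * (F.L : ℝ)) + 2 * 3 + 1) ^ 2 / 2) ^ 2)
          * (2 * ε) ^ 2 * (((F.L : ℝ) ^ (K - n)) ^ 3 * ((F.L : ℝ) ^ (K - n)) ^ 2) * ∑ b : PBond (F.P K) 0, ‖Y b‖ ^ 2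
        = 12 * ((4770 * (F.L : ℝ) ^ 3) ^ 2 * ((5 * (F.L : ℝ)) ^ 2 / 2) ^ 2 / 4
              + (2 * (5 * (F.L : ℝ)) ^ 3 / ((F.L : ℝ) * ((F.L : ℝ) - 1) * ((F.L : ℝ) ^ 2 - 1)) + (2 * (5 * (F.L : ℝ)) + 2 * 3 + 1) ^ 2 / 2) ^ 2)
          * ((F.L : ℝ) ^ (K - n)) ^ 5 * ε ^ 2 * ∑ b : PBond (F.P K) 0, ‖Y b‖ ^ 2 := by
      ring
    linarith only [e1, e2]
  have hmain := sum_normSq_le_curl_sq_of_divBudget_of_structureBudget_T3 F n K U₀ hε.le hε1 hU Y hdivB (Λ (K - n))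
    (fun c => (((F.P K).L : ℝ) ^ (K - n)) ^ (F.P K).d * (‖Q (K - n) Y c‖ + ‖G (K - n) c - S (K - n) c‖
          + ‖S (K - n) c - ((((F.P K).L : ℂ) ^ (K - n)) ^ (F.P K).d)⁻¹ •
        (((holAt U₀ (walk (embIter (K - n) c.src) (treeWord fun _ : Fin (F.P K).d => -((((F.P K).L ^ (K - n) - 1) / 2 : ℕ) : ℤ))) : Matrix.specialUnitaryGroup (Fin 2) ℂ) :
            Matrix (Fin 2) (Fin 2) ℂ)
          * (∑ r : Fin (F.P K).d → Fin ((F.P K).L ^ (K - n)), ∑ s ∈ Finset.range ((F.P K).L ^ (K - n)),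
              conjR (holT (unitsField (toUField U₀)) (Site.fibreSite 0 (K - n) c.src fun _ => ⟨0, pow_pos (F.P K).L_pos (K - n)⟩) (treeWord fun ν => ((r ν : ℕ) : ℤ))
                  * holT (unitsField (toUField U₀)) (Site.fibreSite 0 (K - n) c.src r) (List.replicate s (c.dir, true)))
                (Y ⟨(fun z : Site (F.P K) 0 => z.shift c.dir)^[s] (Site.fibreSite 0 (K - n) c.src r), c.dir⟩))
          * star (((holAt U₀ (walk (embIter (K - n) c.src) (treeWord fun _ : Fin (F.P K).d => -((((F.P K).L ^ (K - n) - 1) / 2 : ℕ) : ℤ))) : Matrix.specialUnitaryGroup (Fin 2) ℂ) :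
              Matrix (Fin 2) (Fin 2) ℂ)))‖))
    (cE := 12 * ((4770 * (F.L : ℝ) ^ 3) ^ 2 * ((5 * (F.L : ℝ)) ^ 2 / 2) ^ 2 / 4
              + (2 * (5 * (F.L : ℝ)) ^ 3 / ((F.L : ℝ) * ((F.L : ℝ) - 1) * ((F.L : ℝ) ^ 2 - 1)) + (2 * (5 * (F.L : ℝ)) + 2 * 3 + 1) ^ 2 / 2) ^ 2)) (ZE := 3 * ((F.L : ℝ) ^ (K - n)) ^ 6 * ZQ) hA hΛ hE'
  have hSY : (0 : ℝ) ≤ ∑ b : PBond (F.P K) 0, ‖Y b‖ ^ 2 := by positivity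
  have e3 : (32 : ℝ) * (((F.L : ℝ) ^ (K - n)) ^ 7)⁻¹ * (3 * ((F.L : ℝ) ^ (K - n)) ^ 6 * ZQ) = 96 * ((F.L : ℝ) ^ (K - n))⁻¹ * ZQ := by
    field_simp
    ring
  have hcoef : (5 / 8 : ℝ) * (((F.L : ℝ) ^ (K - n)) ^ 2)⁻¹ * ∑ b : PBond (F.P K) 0, ‖Y b‖ ^ 2
      ≤ (1 - 32 * (12 * ((4770 * (F.L : ℝ) ^ 3) ^ 2 * ((5 * (F.L : ℝ)) ^ 2 / 2) ^ 2 / 4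
              + (2 * (5 * (F.L : ℝ)) ^ 3 / ((F.L : ℝ) * ((F.L : ℝ) - 1) * ((F.L : ℝ) ^ 2 - 1)) + (2 * (5 * (F.L : ℝ)) + 2 * 3 + 1) ^ 2 / 2) ^ 2)) * ε ^ 2)
        * (((F.L : ℝ) ^ (K - n)) ^ 2)⁻¹ * ∑ b : PBond (F.P K) 0, ‖Y b‖ ^ 2 := by
    have h2 : (0 : ℝ) ≤ (((F.L : ℝ) ^ (K - n)) ^ 2)⁻¹ * ∑ b : PBond (F.P K) 0, ‖Y b‖ ^ 2 := by positivity
    have h1 : (5 / 8 : ℝ) ≤ 1 - 32 * (12 * ((4770 * (F.L : ℝ) ^ 3) ^ 2 * ((5 * (F.L : ℝ)) ^ 2 / 2) ^ 2 / 4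
              + (2 * (5 * (F.L : ℝ)) ^ 3 / ((F.L : ℝ) * ((F.L : ℝ) - 1) * ((F.L : ℝ) ^ 2 - 1)) + (2 * (5 * (F.L : ℝ)) + 2 * 3 + 1) ^ 2 / 2) ^ 2)) * ε ^ 2 := by
      linarith only [hcE]
    calc (5 / 8 : ℝ) * (((F.L : ℝ) ^ (K - n)) ^ 2)⁻¹ * ∑ b : PBond (F.P K) 0, ‖Y b‖ ^ 2
        = (5 / 8 : ℝ) * ((((F.L : ℝ) ^ (K - n)) ^ 2)⁻¹ * ∑ b : PBond (F.P K) 0, ‖Y b‖ ^ 2) := by ring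
      _ ≤ (1 - 32 * (12 * ((4770 * (F.L : ℝ) ^ 3) ^ 2 * ((5 * (F.L : ℝ)) ^ 2 / 2) ^ 2 / 4
              + (2 * (5 * (F.L : ℝ)) ^ 3 / ((F.L : ℝ) * ((F.L : ℝ) - 1) * ((F.L : ℝ) ^ 2 - 1)) + (2 * (5 * (F.L : ℝ)) + 2 * 3 + 1) ^ 2 / 2) ^ 2)) * ε ^ 2)
          * ((((F.L : ℝ) ^ (K - n)) ^ 2)⁻¹ * ∑ b : PBond (F.P K) 0, ‖Y b‖ ^ 2) := mul_le_mul_of_nonneg_right h1 h2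
      _ = _ := by ring
  rw [e3] at hmain
  linarith only [hmain, hcoef]

end Summit.QuantumFields.YangMills.Theorems.Prop7CurvedLandauKnitT3

end
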